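import Literature.NumberTheory.Automorphic.AutomorphicRepsGL2WeightOneCleanModel
import Literature.NumberTheory.Automorphic.AutomorphicRepsGL2WeightOneHeckeEigenform
import Literature.NumberTheory.Automorphic.NewformAdelisationAdjointDegeneracy
import Literature.NumberTheory.EllipticCurves.NewformsSpanGamma1Proofs
import HarnessLib

/-!
# The newform of a clean weight-one automorphic representation of `GL₂(𝔸_ℚ)` with a `K₁`-fixed
# vector (Gelbart 1975, Thm. 5.19; Gelbart 1997, Prop. 2.5, converse, weight one)

Topic `NumberTheory/Automorphic`; theorems only (no definition, no named fact). The weight-one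
dictionary `π ↦ f_π` of Gelbart 1997, Prop. 2.5 in the form consumed by
`exists_isNewform1_of_isPiOfArtinRep_of_dictionary` (`StrongArtinGL2WeightOneDictionary`, hypothesis
`hdesc`) asks, for a clean cuspidal `π₀ = C / ⊥` of weight one with `A_G`-invariant forms
(`AutomorphicRepsGL2WeightOneCleanModel.IsOfWeightOne.exists_clean`), for a **newform** `f` with
`φ_f ∈ C`. This file proves it from the one local input left — the existence of a non-zero
`K₁(N)`-fixed vector in `C` for some `N` (Casselman 1973, Thm. 1, existence half):

* `AutomorphicRepData.IsOfWeightOne.exists_isNewform1_of_fixed` — **if `C` (clean, weight one, cuspidal,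
  `A_G`-invariant forms) has a non-zero `K₁(N)`-fixed vector, then `φ_f ∈ C` for a newform
  `f ∈ S₁(Γ₁(N₀))`, `N₀ ≤ N` the least such level.**

Proof (Gelbart 1975, Thm. 5.19 (b) "conversely … the conductor of `π`", with Casselman's theorem
replaced by its existence half as hypothesis and its "level = conductor" half by the tree's
`NewformAdelisationAdjointDegeneracy`): let `N₀` be the least `N` for which `C^{K₁(N)} ≠ 0`
(`Nat.find`); `AutomorphicRepsGL2WeightOneCleanModel.IsOfWeightOne.exists_cuspForm_of_fixed` descends a
`K₁(N₀)`-fixed weight-one vector to `f₀ ∈ S₁(Γ₁(N₀))`, `f₀ ≠ 0`, `φ_{f₀} ∈ C`; by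
`AutomorphicRepsGL2WeightOneHeckeEigenform` (`exists_heckeT_eq_smul_of_adelicLiftFunA_mem`,
`exists_mem_nebentypusSubspace_of_adelicLiftFunA_mem`) `f₀` is a `T_p`-eigenform for `p ∤ N₀` in some
`S₁(N₀, χ)`; by minimality of `N₀` and `mem_newSubspace1_of_forall_fixed`
(`NewformAdelisationAdjointDegeneracy`: the adjoint degeneracy maps to lower levels adelise to
`K₁(M)`-invariant vectors of `C`, which vanish) `f₀ ∈ S₁(Γ₁(N₀))^{new}`; by Atkin–Lehner–Li on `Γ₁(N₀)`
(`exists_isNewform1_of_mem_newSubspace1`, `atkinLehnerMainLemma1_holds`; Diamond–Shurman Thm. 5.8.2)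
`f₀ = a₁(f₀) f` for a newform `f`, so `φ_f = a₁(f₀)⁻¹ φ_{f₀} ∈ C`.

* `AutomorphicRepData.IsOfWeightOne.exists_isNewform1_of_exists_fixed` — the same with the clean
  model folded in: for every cuspidal `π` of weight one, **granted a non-zero `K₁`-fixed vector in its
  clean model**, a newform `f` of weight one with `φ_f` in the clean model, whose Satake parameters
  are those of `π`.

## References

* S. Gelbart, *Automorphic forms on adele groups* (1975), Thm. 5.19 and its proof, Remark 4.25
  [Gelbart1975].
* S. Gelbart, *Three lectures on the modularity of `ρ̄_{E,3}` …* (1997), Prop. 2.5 (sketch of proof)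
  and Corollary [Gelbart1997].
* W. Casselman, *On some results of Atkin and Lehner*, Math. Ann. 201 (1973), Thm. 1 [Casselman1973].
* F. Diamond, J. Shurman, *A first course in modular forms* (2005), Thm. 5.8.2 [DiamondShurman2005].
-/

-- Mathlib idiom (Mathlib/Algebra/Lie/OfAssociative.lean); needed to mention Lie subalgebras of matrix algebras
attribute [local instance 100] LieRing.ofAssociativeRing

open scoped MatrixGroups Matrix NumberField ModularForm Classical

noncomputable section

open NumberField IsDedekindDomain

namespace Literature.NumberTheory.Automorphic

open EllipticCurves.ModularForms CongruenceSubgroup Rat.HeightOneSpectrum GL2Real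

namespace AutomorphicRepData

variable {hcpt : isCompact_glFiniteIntegralLevel 2 ℚ} {π : AutomorphicRepData (AutomorphyDatum.gl 2 ℚ hcpt)}

attribute [local instance] neZero_natGenerator

/-- **The newform of a clean weight-one `π` with a `K₁`-fixed vector.** Let `π = W / ⊥` be an
automorphic representation of `GL₂(𝔸_ℚ)` of weight one whose forms are `A_G`-invariant cusp forms,
and suppose `W` has a non-zero vector fixed by `{1} × K₁(N)` for some `N ≥ 1`. Then there are a level
`N₀ ≥ 1` and a newform `f ∈ S₁(Γ₁(N₀))` (`IsNewform1`) with `φ_f ∈ W`. (`N₀` is the least level with a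
`K₁(N₀)`-fixed vector; the descended eigenform is new by minimality —
`mem_newSubspace1_of_forall_fixed` — and a new eigenform away from the level is a multiple of a
newform, Diamond–Shurman Thm. 5.8.2.) Gelbart 1975, Thm. 5.19 (b); Gelbart 1997, Prop. 2.5 (converse)
granted the existence of the new vector (Casselman 1973, Thm. 1).
[cite: Gelbart1975, Thm. 5.19] [cite: Gelbart1997, Prop. 2.5 (sketch of proof)]
[cite: DiamondShurman2005, Thm. 5.8.2] -/
theorem IsOfWeightOne.exists_isNewform1_of_fixed (hbot : π.W' = ⊥) (h1 : π.IsOfWeightOne)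
    (hcusp : π.W ≤ cuspFormsGL 2 ℚ hcpt)
    (hAG : ∀ φ ∈ π.W, ∀ z ∈ (AdelicGroupData.gl 2 ℚ).center', ∀ g, φ (z * g) = φ g)
    {N : ℕ} [NeZero N] {φ : (AdelicGroupData.gl 2 ℚ).Adelic → ℂ} (hφ : φ ∈ π.W) (hφ0 : φ ≠ 0)
    (hfix : ∀ u ∈ gammaOneFiniteLevel ℚ (Ideal.span {(N : 𝓞 ℚ)}),
      rightTranslation (AdelicGroupData.gl 2 ℚ) (GLn.ofFinite 2 ℚ u) φ = φ) :
    ∃ (N₀ : ℕ) (_ : NeZero N₀) (f : CuspForm (Gamma1 N₀) 1), IsNewform1 f ∧ adelicLiftFunA N₀ 1 f ∈ π.W := by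
  -- the least level with a `K₁`-fixed vector
  let P : ℕ → Prop := fun n => n ≠ 0 ∧ ∃ ψ ∈ π.W, ψ ≠ 0 ∧
    ∀ u ∈ gammaOneFiniteLevel ℚ (Ideal.span {(n : 𝓞 ℚ)}), rightTranslation (AdelicGroupData.gl 2 ℚ) (GLn.ofFinite 2 ℚ u) ψ = ψ
  have hP : ∃ n, P n := ⟨N, NeZero.ne N, φ, hφ, hφ0, hfix⟩
  set N₀ := Nat.find hP with hN₀def
  obtain ⟨hN₀0, ψ, hψW, hψ0, hψfix⟩ : P N₀ := Nat.find_spec hP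
  have hmin : ∀ m < N₀, ¬ P m := fun m hm => Nat.find_min hP hm
  haveI : NeZero N₀ := ⟨hN₀0⟩
  -- the descended weight-one cusp form `f₀` of level `N₀` with `φ_{f₀} ∈ W`
  obtain ⟨ψ₁, hψ₁W, -, -, -, -, -, f₀, hf₀, hf₀0⟩ := h1.exists_cuspForm_of_fixed hbot hcusp hAG hψW hψ0 hψfix
  have hfW : adelicLiftFunA N₀ 1 f₀ ∈ π.W := by
    have e : adelicLiftFunA N₀ 1 f₀ = ψ₁ := hf₀
    rw [e]; exact hψ₁W
  -- `f₀` is new, by minimality of `N₀`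
  have hstable : ∀ (x : GL (Fin 2) (FiniteAdeleRing (𝓞 ℚ) ℚ)), ∀ φ' ∈ π.W,
      (fun h : GL (Fin 2) (AdeleRing (𝓞 ℚ) ℚ) => φ' (h * GLn.ofFinite 2 ℚ x)) ∈ π.W := fun x φ' hφ' =>
    π.stable.finite_stable (GLn.ofFinite 2 ℚ x) ⟨x, rfl⟩ hφ'
  have hnew : f₀ ∈ newSubspace1 N₀ 1 := by
    refine mem_newSubspace1_of_forall_fixed f₀ (C := π.W) hstable hfW fun M hM φ' hφ'W hφ'fix => ?_
    have hM' := Nat.mem_properDivisors.1 hM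
    by_contra hne
    refine hmin M hM'.2 ⟨(Nat.pos_of_dvd_of_pos hM'.1 (NeZero.pos N₀)).ne', φ', hφ'W, hne, fun u hu => ?_⟩
    funext g
    exact hφ'fix u hu g
  -- `T_p`-eigenvalues for `p ∤ N₀` and the nebentypus
  have hTv : ∀ v : HeightOneSpectrum (𝓞 ℚ), ¬ v.asIdeal ∣ Ideal.span {(N₀ : 𝓞 ℚ)} →
      ∃ a : ℂ, EllipticCurves.ModularForms.heckeT (Gamma1 N₀) 1 (natGenerator v) f₀ = a • f₀ := fun v hv => by
    obtain ⟨a, -, ha, -⟩ := exists_heckeT_eq_smul_of_adelicLiftFunA_mem hbot f₀ hfW hv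
    exact ⟨a, ha⟩
  have hvN : ∀ v : HeightOneSpectrum (𝓞 ℚ), ¬ natGenerator v ∣ N₀ → ¬ v.asIdeal ∣ Ideal.span {(N₀ : 𝓞 ℚ)} :=
    fun v h hv => h ((Rat.natGenerator_dvd_iff v N₀).2 hv)
  have hTp : ∀ (p : ℕ) (hp : p.Prime), ¬ p ∣ N₀ →
      ∃ a : ℂ, (haveI : NeZero p := ⟨hp.ne_zero⟩; EllipticCurves.ModularForms.heckeT (Gamma1 N₀) 1 p f₀) = a • f₀ := by
    intro p hp hpN
    set v : HeightOneSpectrum (𝓞 ℚ) := (primesEquiv (R := 𝓞 ℚ)).symm ⟨p, hp⟩ with hvdef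
    have hvp : natGenerator v = p := natGenerator_primesEquiv_symm' ⟨p, hp⟩
    obtain ⟨a, ha⟩ := hTv v (hvN v (by rw [hvp]; exact hpN))
    refine ⟨a, ?_⟩
    have gen : ∀ (q : ℕ) (hq : NeZero q), q = p →
        (haveI := hq; EllipticCurves.ModularForms.heckeT (Gamma1 N₀) 1 q f₀) = a • f₀ →
          (haveI : NeZero p := ⟨hp.ne_zero⟩; EllipticCurves.ModularForms.heckeT (Gamma1 N₀) 1 p f₀) = a • f₀ := by
      rintro q hq rfl h; exact h
    exact gen (natGenerator v) inferInstance hvp ha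
  let a : ℕ → ℂ := fun p => if h : p.Prime ∧ ¬ p ∣ N₀ then Classical.choose (hTp p h.1 h.2) else 0
  have hT : ∀ (p : ℕ) (hp : p.Prime), ¬ p ∣ N₀ →
      (haveI : NeZero p := ⟨hp.ne_zero⟩; EllipticCurves.ModularForms.heckeT (Gamma1 N₀) 1 p f₀) = a p • f₀ := by
    intro p hp hpN
    have hdef : a p = Classical.choose (hTp p hp hpN) := dif_pos ⟨hp, hpN⟩
    rw [hdef]
    exact Classical.choose_spec (hTp p hp hpN)
  obtain ⟨χ, hfχ⟩ := exists_mem_nebentypusSubspace_of_adelicLiftFunA_mem hbot hf₀0 hfW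
  have hD : ∀ d : (ZMod N₀)ˣ, ∃ c : ℂ, diamondOp N₀ 1 (d : ZMod N₀) f₀ = c • f₀ := fun d =>
    ⟨χ (d : ZMod N₀), (mem_nebentypusSubspace_iff_diamondOp.mp hfχ) d⟩
  -- Atkin–Lehner–Li: `f₀ = a₁(f₀) f` with `f` a newform
  obtain ⟨f, hf, hf₀f⟩ := exists_isNewform1_of_mem_newSubspace1 (atkinLehnerMainLemma1_holds N₀ 1) hnew hf₀0 a hT hD
  set c : ℂ := (UpperHalfPlane.qExpansion 1 ⇑f₀).coeff 1 with hc
  have hc0 : c ≠ 0 := fun h0 => hf₀0 (by rw [hf₀f, h0, zero_smul])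
  refine ⟨N₀, inferInstance, f, hf, ?_⟩
  -- `φ_f = c⁻¹ φ_{f₀} ∈ W`
  have ef : (f : CuspForm (Gamma1 N₀) 1) = c⁻¹ • f₀ := by rw [hf₀f, smul_smul, inv_mul_cancel₀ hc0, one_smul]
  have hr : ∀ (F : CuspForm (Gamma1 N₀) 1), ∀ κ ∈ gammaOneFiniteLevel ℚ (Ideal.span {(N₀ : 𝓞 ℚ)}),
      ∀ g : GL (Fin 2) (AdeleRing (𝓞 ℚ) ℚ), adelicLiftFun N₀ 1 ⇑F (g * GLn.ofFinite 2 ℚ κ) = adelicLiftFun N₀ 1 ⇑F g :=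
    fun F κ hκ g => adelicLiftFun_mul_of_archGL_eq_one F (Rat.archGL_ofFinite κ) (by rwa [GLn.sndHom_ofFinite]) g
  have e : adelicLiftFunA N₀ 1 f = c⁻¹ • adelicLiftFunA N₀ 1 f₀ := by
    change adelicLiftFun N₀ 1 ⇑f = c⁻¹ • adelicLiftFun N₀ 1 ⇑f₀
    refine eq_of_invariant_of_ofRealGL (M := N₀) (adelicLiftFun_ofGlobal_mul f)
      (fun γ g => by simp only [Pi.smul_apply, adelicLiftFun_ofGlobal_mul]) (hr f)
      (fun κ hκ g => by simp only [Pi.smul_apply, hr f₀ κ hκ g]) fun g hg => ?_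
    rw [Pi.smul_apply, smul_eq_mul, ef, adelicLiftFun_coe_smul_ofRealGL c⁻¹ f₀ hg]
  rw [e]
  exact π.W.smul_mem _ hfW

/-- **The weight-one dictionary `π ↦ f_π` granted the new vector.** For every cuspidal `π` of
`GL₂(𝔸_ℚ)` of weight one there is a clean cuspidal `π₀ = C / ⊥` of weight one with `C ≤ W`,
`A_G`-invariant forms and the Satake parameters of `π` (`IsOfWeightOne.exists_clean`), and **if `C`
has a non-zero `K₁(N)`-fixed vector for some `N ≥ 1`, then `φ_f ∈ C` for a newform `f ∈ S₁(Γ₁(N₀))`**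
(`exists_isNewform1_of_fixed`). What is left of Gelbart's Prop. 2.5 (converse, weight one) is the
existence of the new vector (Casselman 1973, Thm. 1). [cite: Gelbart1997, Prop. 2.5 and Corollary]
[cite: Gelbart1975, Thm. 5.19] [cite: Casselman1973, Thm. 1] -/
theorem IsOfWeightOne.exists_isNewform1_of_exists_fixed {π : CuspidalAutomorphicRepData 2 ℚ hcpt}
    (hπ : π.1.IsOfWeightOne)
    (hfix : ∀ π₀ : CuspidalAutomorphicRepData 2 ℚ hcpt, π₀.1.W' = ⊥ → π₀.1.IsOfWeightOne →
      (∀ φ ∈ π₀.1.W, ∀ z ∈ (AdelicGroupData.gl 2 ℚ).center', ∀ g, φ (z * g) = φ g) →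
      ∃ (N : ℕ) (_ : NeZero N), ∃ φ ∈ π₀.1.W, φ ≠ 0 ∧
        ∀ u ∈ gammaOneFiniteLevel ℚ (Ideal.span {(N : 𝓞 ℚ)}),
          rightTranslation (AdelicGroupData.gl 2 ℚ) (GLn.ofFinite 2 ℚ u) φ = φ) :
    ∃ π₀ : CuspidalAutomorphicRepData 2 ℚ hcpt, π₀.1.W' = ⊥ ∧ π₀.1.IsOfWeightOne ∧ π₀.1.W ≤ π.1.W ∧
      (∀ (v : HeightOneSpectrum (𝓞 ℚ)) (β : Multiset ℂ),
        π₀.1.HasSatakeParamAt v β → π.1.HasSatakeParamAt v β) ∧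
      ∃ (N₀ : ℕ) (_ : NeZero N₀) (f : CuspForm (Gamma1 N₀) 1), IsNewform1 f ∧ adelicLiftFunA N₀ 1 f ∈ π₀.1.W := by
  obtain ⟨π₀, hbot, h₀, hle, hAG, -, hsat⟩ := hπ.exists_clean
  obtain ⟨N, hN, φ, hφ, hφ0, hφfix⟩ := hfix π₀ hbot h₀ hAG
  exact ⟨π₀, hbot, h₀, hle, hsat, h₀.exists_isNewform1_of_fixed hbot π₀.2 hAG hφ hφ0 hφfix⟩

end AutomorphicRepData

end Literature.NumberTheory.Automorphic

end
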